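import Summits.KontsevichZagierPeriods.KontsevichZagierPeriods.Theorems.LinRedNormalFormArrangementNormalFormSeparateTaylor

/-!
# Cancelling a fat letter: the algebra (stub `stub_separateThreeZero`, part `FatAlgebra`)

(Line `janus-bands`, crux `ArrangementNormalForm`, stub `stub_separateThreeZero` — fibre-free
separation over a bounded rational polytope in `ℝ³`, `JJ 3 0 → closure (GG 2 1 0)`; part
`FatAlgebra` of the CANCELLATION lemma `JJ 3 0 ≡ thin JJ 3 0`.)

The thin assembly `separateThreeZero_of_hI3_thin` needs every active letter plane to meet the
closed cell inside a line. A FAT active `y`-letter `α (y − c(x'))` (2-dimensional contact) is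
cancelled against the numerator: absolute convergence forces the numerator `p` to vanish on the
contact (part `Fat`), hence — this part — on the whole plane `y = c(x')`, i.e. the constant
Taylor coefficient `q₀` of `p = ∑ qᵢ(x') (y − c(x'))^i` (`SeparatePos.exists_taylor`) vanishes
(`SepThree.fat_q0_eq`: `q₀(x') = p(x', c(x'))`; `SepThree.fat_eq_zero_of_ball`: a rational
polynomial vanishing on a real ball is zero, `MvPolynomial.funext_set`), and then
`p = (y − c(x')) · p₁` at every real point for an explicit polynomial `p₁`
(`SepThree.fat_factor`, registered as `separateThree_fat_factor`).
-/

noncomputable section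

open Set MvPolynomial

namespace Summit.KontsevichZagierPeriods.ArrangementNormalForm.JanusBands

namespace SepThree

/-- **Identity principle**: a rational polynomial vanishing on a real ball vanishes. -/
theorem fat_eq_zero_of_ball {n : ℕ} (q : MvPolynomial (Fin n) ℚ) (x₀ : Fin n → ℝ) {ρ : ℝ}
    (hρ : 0 < ρ) (h : ∀ x : Fin n → ℝ, dist x x₀ < ρ → MvPolynomial.aeval x q = 0) : q = 0 := by
  have hmap : MvPolynomial.map (algebraMap ℚ ℝ) q = 0 := by
    refine MvPolynomial.funext_set (fun i => Ioo (x₀ i - ρ) (x₀ i + ρ))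
      (fun i => Ioo_infinite (by linarith)) fun x hx => ?_
    rw [map_zero, MvPolynomial.eval_map]
    refine (MvPolynomial.aeval_def x q).symm.trans (h x ((dist_pi_lt_iff hρ).2 fun i => ?_))
    have := hx i (Set.mem_univ i)
    rw [Real.dist_eq, abs_lt]
    constructor <;> linarith [this.1, this.2]
  exact MvPolynomial.map_injective _ (algebraMap ℚ ℝ).injective (by rw [hmap, map_zero])

variable {b : ℕ}

/-- The constant Taylor coefficient is the restriction to the centre: `q₀(x') = p(x', c(x'))`. -/
theorem fat_q0_eq (c : MvPolynomial (Fin b) ℚ) (p : MvPolynomial (Fin (b + 1)) ℚ) {N : ℕ}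
    {q : ℕ → MvPolynomial (Fin b) ℚ}
    (h : ∀ (x : Fin b → ℝ) (y : ℝ), MvPolynomial.aeval (Fin.snoc x y : Fin (b + 1) → ℝ) p =
      ∑ i ∈ Finset.range N, MvPolynomial.aeval x (q i) * (y - MvPolynomial.aeval x c) ^ i)
    (hN : 0 < N) (x : Fin b → ℝ) :
    MvPolynomial.aeval x (q 0) =
      MvPolynomial.aeval (Fin.snoc x (MvPolynomial.aeval x c) : Fin (b + 1) → ℝ) p := by
  rw [h x, Finset.sum_eq_single 0 (fun i _ hi => by rw [sub_self, zero_pow hi, mul_zero])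
    (fun h0 => absurd (Finset.mem_range.2 hN) h0), pow_zero, mul_one]

/-- **Factorisation**: if the constant Taylor coefficient vanishes, `p = (y − c(x')) · p₁`. -/
theorem fat_factor (c : MvPolynomial (Fin b) ℚ) (p : MvPolynomial (Fin (b + 1)) ℚ) {N : ℕ}
    {q : ℕ → MvPolynomial (Fin b) ℚ}
    (h : ∀ (x : Fin b → ℝ) (y : ℝ), MvPolynomial.aeval (Fin.snoc x y : Fin (b + 1) → ℝ) p =
      ∑ i ∈ Finset.range N, MvPolynomial.aeval x (q i) * (y - MvPolynomial.aeval x c) ^ i)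
    (hq0 : q 0 = 0) :
    ∃ p₁ : MvPolynomial (Fin (b + 1)) ℚ, ∀ (x : Fin b → ℝ) (y : ℝ),
      MvPolynomial.aeval (Fin.snoc x y : Fin (b + 1) → ℝ) p =
        (y - MvPolynomial.aeval x c) * MvPolynomial.aeval (Fin.snoc x y : Fin (b + 1) → ℝ) p₁ := by
  refine ⟨∑ i ∈ Finset.range (N - 1), MvPolynomial.rename Fin.castSucc (q (i + 1)) *
    (X (Fin.last b) - MvPolynomial.rename Fin.castSucc c) ^ i, fun x y => ?_⟩
  have hr : ∀ r : MvPolynomial (Fin b) ℚ, MvPolynomial.aeval (Fin.snoc x y : Fin (b + 1) → ℝ)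
      (MvPolynomial.rename Fin.castSucc r) = MvPolynomial.aeval x r := fun r => by
    rw [MvPolynomial.aeval_rename]
    have hc : (Fin.snoc x y : Fin (b + 1) → ℝ) ∘ Fin.castSucc = x :=
      funext fun i => by simp
    rw [hc]
  rw [h x y]
  rcases Nat.eq_zero_or_pos N with rfl | hN
  · simp
  · obtain ⟨N', rfl⟩ : ∃ N', N = N' + 1 := ⟨N - 1, by omega⟩
    rw [Finset.sum_range_succ', hq0, map_zero, zero_mul, add_zero, Nat.add_sub_cancel]
    simp only [map_sum, map_mul, map_pow, map_sub, MvPolynomial.aeval_X, Fin.snoc_last, hr,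
      Finset.mul_sum]
    refine Finset.sum_congr rfl fun i _ => ?_
    ring

end SepThree

open SepThree in
/-- **Factorisation of the numerator along a letter with vanishing constant Taylor coefficient**
(registered sub-goal of `stub_separateThreeZero`, part `FatAlgebra`; see `SepThree.fat_factor`). -/
theorem separateThree_fat_factor (b : ℕ) (c : MvPolynomial (Fin b) ℚ) (p : MvPolynomial (Fin (b + 1)) ℚ) (N : ℕ) (q : ℕ → MvPolynomial (Fin b) ℚ) (h : ∀ (x : Fin b → ℝ) (y : ℝ), MvPolynomial.aeval (Fin.snoc x y : Fin (b + 1) → ℝ) p = ∑ i ∈ Finset.range N, MvPolynomial.aeval x (q i) * (y - MvPolynomial.aeval x c) ^ i) (hq0 : q 0 = 0) : ∃ p₁ : MvPolynomial (Fin (b + 1)) ℚ, ∀ (x : Fin b → ℝ) (y : ℝ), MvPolynomial.aeval (Fin.snoc x y : Fin (b + 1) → ℝ) p = (y - MvPolynomial.aeval x c) * MvPolynomial.aeval (Fin.snoc x y : Fin (b + 1) → ℝ) p₁ :=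
  fat_factor c p h hq0

end Summit.KontsevichZagierPeriods.ArrangementNormalForm.JanusBands
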